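import Summits.ValiantsHypothesis.ValiantsHypothesis.Theorems.LacunarySymmetroidMatrixDescartesVSQDefs
import Summits.ValiantsHypothesis.ValiantsHypothesis.Theorems.SymmetroidPencilBasics

/-!
# `MatrixDescartes` census, `m = 2` row — the «Viro + square splitting» KIT: dominance and sign rules for signed `B`-adic `K`-nomials

HONEST FRAMING.  Elementary real-analysis lemmas (val-V1-extremal engine seat val-v1x-eng-6 g2) about the objects of
`…VSQDefs`, used by the all-`K` law `ζ_sym(2,K) ≥ 4K − 7` (`…VSQPoints`, `…VSQLaw`).  Nothing here mentions the crux
`MatrixDescartes` (stmt-ValiantsHypothesis-18050, asymptotic) or `VP ≠ VNP`; no statement of the tree is strengthened or weakened.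

CONTENT (`f = bnom B s h d`, `|s_l| ≤ 1`; `Dom … t l₀`: every other present term is `≤ tv l₀ / B` at `t`):
* `abs_bnom_sub_le` / `abs_bnom_le` — `f = s_{l₀}·V·(1 + O(K/B))`, `|f| ≤ K·M`;
* `bnom_pos_of_dom` / `bnom_neg_of_dom` / `sign_mul_bnom_pos` — the dominant term decides the sign of `f` (`B ≥ 4K`);
* `eval_det_sym2` — `det (∑ t^{d_l} S_l) = a c − b²` for the symmetric `2 × 2` letters `sym2`;
* `det_pos_of_domU` / `det_neg_of_domW` — U-rule: dominant terms of `a` and `c` whose product beats `B·(max b-term)²` give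
  `det` the sign of that product; W-rule: a dominant term of `b` whose square beats `B·(max a-term)(max c-term)` gives
  `det < 0` (`B ≥ 4K²`);
* `dom_zpow`, `below_zpow`, `gapU_zpow`, `gapW_zpow` — at `t = B^x`, `x ∈ ℤ`, all hypotheses are integer exponent bookkeeping;
* `dom_mono_right` / `dom_mono_left` — dominance with a unit to spare propagates from an endpoint across an interval (to the
  right against smaller exponents, to the left against larger ones): this certifies the signs of `a` and `c` at the
  NON-explicit zero of `b` inside a bracket — the SQUARE-SPLITTING step `det = ac − 0 > 0` that a pure patchworking count
  (tree `det_patch_sign`: one uniquely dominant Leibniz term) cannot see;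
* `exists_zero_of_sign_change` — the bracketed zero (intermediate value theorem).
[folklore] Dominance / Viro patchworking bookkeeping; intermediate value theorem.
-/

set_option linter.dupNamespace false
set_option autoImplicit false

namespace Summit.ValiantsHypothesis.ValiantsHypothesis.Theorems.LacunarySymmetroidMatrixDescartes.VSQ

open scoped BigOperators
open Finset Polynomial

variable {K : ℕ}

/-! ## 1. Signed `B`-adic `K`-nomials -/

/-- term sizes are positive for `B, t > 0`. [folklore] -/
theorem tv_pos {B : ℝ} (hB : 0 < B) (h : ℤ) (d : ℕ) {t : ℝ} (ht : 0 < t) : 0 < tv B h d t :=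
  mul_pos (zpow_pos hB _) (pow_pos ht _)

/-- at `t = B^x`: `B^h · (B^x)^d = B^{h + x d}`. [folklore] -/
theorem tv_zpow {B : ℝ} (hB : 0 < B) (h x : ℤ) (d : ℕ) : tv B h d (B ^ x) = B ^ (h + x * d) := by
  unfold tv
  rw [← zpow_natCast (B ^ x) d, ← zpow_mul, ← zpow_add₀ hB.ne']

/-- `bnom` is continuous in `t`. [folklore] -/
theorem continuous_bnom (B : ℝ) (s : Fin K → ℝ) (h : Fin K → ℤ) (d : Fin K → ℕ) :
    Continuous (fun t => bnom B s h d t) := by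
  unfold bnom tv
  fun_prop

/-- **dominance estimate**: `|f − s_{l₀} V| ≤ (K/B)·V`, `V = tv l₀`. [folklore] -/
theorem abs_bnom_sub_le {B : ℝ} (hB : 0 < B) {s : Fin K → ℝ} (hs : ∀ l, |s l| ≤ 1) (h : Fin K → ℤ) (d : Fin K → ℕ)
    {t : ℝ} (ht : 0 < t) (l₀ : Fin K) (hdom : Dom B s h d t l₀) :
    |bnom B s h d t - s l₀ * tv B (h l₀) (d l₀) t| ≤ (K : ℝ) / B * tv B (h l₀) (d l₀) t := by
  classical
  unfold bnom
  rw [← Finset.sum_erase_add _ _ (Finset.mem_univ l₀), add_sub_cancel_right]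
  set V := tv B (h l₀) (d l₀) t with hV
  have hV0 : 0 < V := tv_pos hB _ _ ht
  have hterm : ∀ l ∈ univ.erase l₀, |s l * tv B (h l) (d l) t| ≤ V / B := by
    intro l hl
    have hne : l ≠ l₀ := Finset.ne_of_mem_erase hl
    rcases hdom l hne with h0 | hle
    · rw [h0, zero_mul, abs_zero]; positivity
    · rw [abs_mul, abs_of_pos (tv_pos hB _ _ ht)]
      calc |s l| * tv B (h l) (d l) t ≤ 1 * tv B (h l) (d l) t :=
            mul_le_mul_of_nonneg_right (hs l) (tv_pos hB _ _ ht).le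
        _ ≤ V / B := by rw [one_mul, le_div_iff₀ hB, mul_comm]; exact hle
  calc |∑ l ∈ univ.erase l₀, s l * tv B (h l) (d l) t|
      ≤ ∑ l ∈ univ.erase l₀, |s l * tv B (h l) (d l) t| := abs_sum_le_sum_abs _ _
    _ ≤ ∑ _l ∈ univ.erase l₀, V / B := sum_le_sum hterm
    _ = ((univ.erase l₀).card : ℝ) * (V / B) := by rw [sum_const, nsmul_eq_mul]
    _ ≤ (K : ℝ) * (V / B) := by
        refine mul_le_mul_of_nonneg_right ?_ (by positivity)
        have : (univ.erase l₀).card ≤ K := (card_erase_le).trans (by simp)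
        exact_mod_cast this
    _ = (K : ℝ) / B * V := by ring

/-- **size estimate**: if every present term is `≤ M` then `|f| ≤ K·M`. [folklore] -/
theorem abs_bnom_le {B : ℝ} (hB : 0 < B) {s : Fin K → ℝ} (hs : ∀ l, |s l| ≤ 1) (h : Fin K → ℤ) (d : Fin K → ℕ)
    {t : ℝ} (ht : 0 < t) {M : ℝ} (hM : 0 ≤ M) (hb : Below B s h d t M) :
    |bnom B s h d t| ≤ (K : ℝ) * M := by
  unfold bnom
  have hterm : ∀ l ∈ (univ : Finset (Fin K)), |s l * tv B (h l) (d l) t| ≤ M := by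
    intro l _
    rcases hb l with h0 | hle
    · rw [h0, zero_mul, abs_zero]; exact hM
    · rw [abs_mul, abs_of_pos (tv_pos hB _ _ ht)]
      calc |s l| * tv B (h l) (d l) t ≤ 1 * tv B (h l) (d l) t :=
            mul_le_mul_of_nonneg_right (hs l) (tv_pos hB _ _ ht).le
        _ ≤ M := by rw [one_mul]; exact hle
  calc |∑ l, s l * tv B (h l) (d l) t| ≤ ∑ l, |s l * tv B (h l) (d l) t| := abs_sum_le_sum_abs _ _
    _ ≤ ∑ _l : Fin K, M := sum_le_sum hterm
    _ = (K : ℝ) * M := by simp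

/-- a dominant term of sign `+1` makes `f > 0` (`B ≥ 4K`). [folklore] -/
theorem bnom_pos_of_dom {B : ℝ} (hKB : 4 * (K : ℝ) ≤ B) (hB : 0 < B) {s : Fin K → ℝ} (hs : ∀ l, |s l| ≤ 1)
    (h : Fin K → ℤ) (d : Fin K → ℕ) {t : ℝ} (ht : 0 < t) {l₀ : Fin K} (hl : s l₀ = 1) (hdom : Dom B s h d t l₀) :
    0 < bnom B s h d t := by
  have hV := tv_pos hB (h l₀) (d l₀) ht
  have hest := abs_bnom_sub_le hB hs h d ht l₀ hdom
  rw [hl, one_mul] at hest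
  have hKB' : (K : ℝ) / B ≤ 1 / 4 := by
    rw [div_le_iff₀ hB]; linarith
  have h1 : (K : ℝ) / B * tv B (h l₀) (d l₀) t ≤ 1 / 4 * tv B (h l₀) (d l₀) t :=
    mul_le_mul_of_nonneg_right hKB' hV.le
  have h2 := (abs_le.1 (hest.trans h1)).1
  linarith

/-- a dominant term of sign `−1` makes `f < 0` (`B ≥ 4K`). [folklore] -/
theorem bnom_neg_of_dom {B : ℝ} (hKB : 4 * (K : ℝ) ≤ B) (hB : 0 < B) {s : Fin K → ℝ} (hs : ∀ l, |s l| ≤ 1)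
    (h : Fin K → ℤ) (d : Fin K → ℕ) {t : ℝ} (ht : 0 < t) {l₀ : Fin K} (hl : s l₀ = -1) (hdom : Dom B s h d t l₀) :
    bnom B s h d t < 0 := by
  have hV := tv_pos hB (h l₀) (d l₀) ht
  have hest := abs_bnom_sub_le hB hs h d ht l₀ hdom
  rw [hl] at hest
  have hKB' : (K : ℝ) / B ≤ 1 / 4 := by
    rw [div_le_iff₀ hB]; linarith
  have h1 : (K : ℝ) / B * tv B (h l₀) (d l₀) t ≤ 1 / 4 * tv B (h l₀) (d l₀) t :=
    mul_le_mul_of_nonneg_right hKB' hV.le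
  have h2 := (abs_le.1 (hest.trans h1)).2
  linarith

/-- a dominant term decides the sign: `s_{l₀} · f > 0` (`B ≥ 4K`). [folklore] -/
theorem sign_mul_bnom_pos {B : ℝ} (hKB : 4 * (K : ℝ) ≤ B) (hB : 0 < B) {s : Fin K → ℝ} (hs : ∀ l, |s l| ≤ 1)
    (h : Fin K → ℤ) (d : Fin K → ℕ) {t : ℝ} (ht : 0 < t) {l₀ : Fin K} (hl : |s l₀| = 1) (hdom : Dom B s h d t l₀) :
    0 < s l₀ * bnom B s h d t := by
  have hV := tv_pos hB (h l₀) (d l₀) ht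
  have hest := abs_bnom_sub_le hB hs h d ht l₀ hdom
  have hKB' : (K : ℝ) / B ≤ 1 / 4 := by
    rw [div_le_iff₀ hB]; linarith
  have h1 : (K : ℝ) / B * tv B (h l₀) (d l₀) t ≤ 1 / 4 * tv B (h l₀) (d l₀) t :=
    mul_le_mul_of_nonneg_right hKB' hV.le
  have hss : s l₀ * s l₀ = 1 := by rw [← abs_mul_abs_self, hl, one_mul]
  have e : s l₀ * bnom B s h d t = tv B (h l₀) (d l₀) t + s l₀ * (bnom B s h d t - s l₀ * tv B (h l₀) (d l₀) t) := by
    have : s l₀ * (s l₀ * tv B (h l₀) (d l₀) t) = tv B (h l₀) (d l₀) t := by rw [← mul_assoc, hss, one_mul]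
    rw [mul_sub, this]; ring
  have hb : |s l₀ * (bnom B s h d t - s l₀ * tv B (h l₀) (d l₀) t)| ≤ 1 / 4 * tv B (h l₀) (d l₀) t := by
    rw [abs_mul, hl, one_mul]; exact hest.trans h1
  have h2 := (abs_le.1 hb).1
  rw [e]; linarith

/-! ## 2. The symmetric `2 × 2` pencil of three signed `B`-adic `K`-nomials and the two sign rules -/

/-- the letters are symmetric. [folklore] -/
theorem sym2_isSymm (B : ℝ) (sa sb sc : Fin K → ℝ) (ha hb hc : Fin K → ℤ) (l : Fin K) :
    (sym2 B sa sb sc ha hb hc l).IsSymm := by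
  unfold Matrix.IsSymm sym2
  ext i j
  fin_cases i <;> fin_cases j <;> rfl

/-- `det (∑_l t^{d_l} S_l) = a(t) c(t) − b(t)²` for the three entry `K`-nomials. [folklore] -/
theorem eval_det_sym2 (B : ℝ) (sa sb sc : Fin K → ℝ) (ha hb hc : Fin K → ℤ) (d : Fin K → ℕ) (t : ℝ) :
    ((∑ l, (X : ℝ[X]) ^ d l • (sym2 B sa sb sc ha hb hc l).map Polynomial.C).det).eval t =
      bnom B sa ha d t * bnom B sc hc d t - (bnom B sb hb d t) ^ 2 := by
  rw [Summit.ValiantsHypothesis.ValiantsHypothesis.Theorems.SymmetroidDescartes.eval_det_pencil,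
    Matrix.det_fin_two]
  simp only [Matrix.sum_apply, Matrix.smul_apply, sym2, smul_eq_mul, bnom, tv, Matrix.of_apply,
    Matrix.cons_val', Matrix.cons_val_zero, Matrix.cons_val_one, Matrix.empty_val',
    Matrix.cons_val_fin_one]
  have e1 : ∀ (s : Fin K → ℝ) (hh : Fin K → ℤ), ∑ l, t ^ d l * (s l * B ^ hh l) = ∑ l, s l * (B ^ hh l * t ^ d l) :=
    fun s hh => Finset.sum_congr rfl fun l _ => by ring
  rw [e1, e1, e1]
  ring

/-- `|x| = 1 ⇒ x·x = 1`. [folklore] -/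
theorem mul_self_eq_one_of_abs {x : ℝ} (hx : |x| = 1) : x * x = 1 := by
  rw [← abs_mul_abs_self, hx, one_mul]

/-- **U-rule.**  If `a` has a dominant term at `lₐ` (size `Vₐ`), `c` one at `l_c` (size `V_c`), every `b`-term is `≤ M` and
`B·M² ≤ Vₐ V_c` (the product `a_{lₐ} c_{l_c} t^{…}` beats `b²` with a unit of `B` to spare), then `det = ac − b²` has the sign
`s^a_{lₐ} s^c_{l_c}` (`B ≥ 4K²`). [folklore] -/
theorem det_pos_of_domU {B : ℝ} (hK : 1 ≤ K) (hKB : 4 * (K : ℝ) ^ 2 ≤ B) {t : ℝ} (ht : 0 < t)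
    {sa sb sc : Fin K → ℝ} (hsa : ∀ l, |sa l| ≤ 1) (hsb : ∀ l, |sb l| ≤ 1) (hsc : ∀ l, |sc l| ≤ 1)
    (ha hb hc : Fin K → ℤ) (d : Fin K → ℕ) {la lc : Fin K} (hla : |sa la| = 1) (hlc : |sc lc| = 1)
    (hda : Dom B sa ha d t la) (hdc : Dom B sc hc d t lc) {M : ℝ} (hM : 0 ≤ M) (hbM : Below B sb hb d t M)
    (hgap : B * M ^ 2 ≤ tv B (ha la) (d la) t * tv B (hc lc) (d lc) t) :
    0 < (sa la * sc lc) * (bnom B sa ha d t * bnom B sc hc d t - (bnom B sb hb d t) ^ 2) := by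
  have hK1 : (1 : ℝ) ≤ K := by exact_mod_cast hK
  have hB : 0 < B := by nlinarith
  have hKB1 : 4 * (K : ℝ) ≤ B := by nlinarith
  set Va := tv B (ha la) (d la) t with hVa
  set Vc := tv B (hc lc) (d lc) t with hVc
  have hVa0 : 0 < Va := tv_pos hB _ _ ht
  have hVc0 : 0 < Vc := tv_pos hB _ _ ht
  have hq : (K : ℝ) / B ≤ 1 / 4 := by rw [div_le_iff₀ hB]; linarith
  -- a = sa Va + ρa, c = sc Vc + ρc, |ρ| ≤ V/4
  have hea := abs_bnom_sub_le hB hsa ha d ht la hda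
  have hec := abs_bnom_sub_le hB hsc hc d ht lc hdc
  have hea' : |bnom B sa ha d t - sa la * Va| ≤ 1 / 4 * Va :=
    hea.trans (mul_le_mul_of_nonneg_right hq hVa0.le)
  have hec' : |bnom B sc hc d t - sc lc * Vc| ≤ 1 / 4 * Vc :=
    hec.trans (mul_le_mul_of_nonneg_right hq hVc0.le)
  -- sa·a ≥ (3/4) Va, sc·c ≥ (3/4) Vc
  have hsa1 := mul_self_eq_one_of_abs hla
  have hsc1 := mul_self_eq_one_of_abs hlc
  have h1 : 3 / 4 * Va ≤ sa la * bnom B sa ha d t := by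
    have e : sa la * bnom B sa ha d t = Va + sa la * (bnom B sa ha d t - sa la * Va) := by
      have : sa la * (sa la * Va) = Va := by rw [← mul_assoc, hsa1, one_mul]
      rw [mul_sub, this]; ring
    have hb : |sa la * (bnom B sa ha d t - sa la * Va)| ≤ 1 / 4 * Va := by
      rw [abs_mul, hla, one_mul]; exact hea'
    have := (abs_le.1 hb).1
    linarith
  have h2 : 3 / 4 * Vc ≤ sc lc * bnom B sc hc d t := by
    have e : sc lc * bnom B sc hc d t = Vc + sc lc * (bnom B sc hc d t - sc lc * Vc) := by
      have : sc lc * (sc lc * Vc) = Vc := by rw [← mul_assoc, hsc1, one_mul]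
      rw [mul_sub, this]; ring
    have hb : |sc lc * (bnom B sc hc d t - sc lc * Vc)| ≤ 1 / 4 * Vc := by
      rw [abs_mul, hlc, one_mul]; exact hec'
    have := (abs_le.1 hb).1
    linarith
  have h12 : 9 / 16 * (Va * Vc) ≤ (sa la * sc lc) * (bnom B sa ha d t * bnom B sc hc d t) := by
    have := mul_le_mul h1 h2 (by positivity) (le_trans (by positivity) h1)
    calc 9 / 16 * (Va * Vc) = (3 / 4 * Va) * (3 / 4 * Vc) := by ring
      _ ≤ (sa la * bnom B sa ha d t) * (sc lc * bnom B sc hc d t) := this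
      _ = (sa la * sc lc) * (bnom B sa ha d t * bnom B sc hc d t) := by ring
  -- b² ≤ K² M² ≤ Va Vc / 4
  have hb1 : |bnom B sb hb d t| ≤ (K : ℝ) * M := abs_bnom_le hB hsb hb d ht hM hbM
  have hb2 : (bnom B sb hb d t) ^ 2 ≤ ((K : ℝ) * M) ^ 2 := by
    rw [← sq_abs (bnom B sb hb d t)]
    exact pow_le_pow_left₀ (abs_nonneg _) hb1 2
  have hb3 : ((K : ℝ) * M) ^ 2 ≤ 1 / 4 * (Va * Vc) := by
    have : ((K : ℝ) * M) ^ 2 * B = (K : ℝ) ^ 2 * (B * M ^ 2) := by ring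
    have h' : ((K : ℝ) * M) ^ 2 * B ≤ (K : ℝ) ^ 2 * (Va * Vc) := by
      rw [this]; exact mul_le_mul_of_nonneg_left hgap (by positivity)
    have h'' : (K : ℝ) ^ 2 * (Va * Vc) ≤ (1 / 4 * (Va * Vc)) * B := by nlinarith [mul_pos hVa0 hVc0]
    exact le_of_mul_le_mul_right (h'.trans h'') hB
  have hss : |sa la * sc lc| = 1 := by rw [abs_mul, hla, hlc, one_mul]
  have hb4 : (sa la * sc lc) * (bnom B sb hb d t) ^ 2 ≤ 1 / 4 * (Va * Vc) := by
    calc (sa la * sc lc) * (bnom B sb hb d t) ^ 2 ≤ |(sa la * sc lc) * (bnom B sb hb d t) ^ 2| := le_abs_self _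
      _ = (bnom B sb hb d t) ^ 2 := by rw [abs_mul, hss, one_mul, abs_of_nonneg (sq_nonneg _)]
      _ ≤ 1 / 4 * (Va * Vc) := hb2.trans hb3
  rw [mul_sub]
  nlinarith [mul_pos hVa0 hVc0]

/-- **W-rule.**  If `b` has a dominant term at `l_b` (size `V_b`), every `a`-term is `≤ Mₐ`, every `c`-term `≤ M_c` and
`B·Mₐ M_c ≤ V_b²`, then `det = ac − b² < 0` (`B ≥ 4K²`). [folklore] -/
theorem det_neg_of_domW {B : ℝ} (hK : 1 ≤ K) (hKB : 4 * (K : ℝ) ^ 2 ≤ B) {t : ℝ} (ht : 0 < t)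
    {sa sb sc : Fin K → ℝ} (hsa : ∀ l, |sa l| ≤ 1) (hsb : ∀ l, |sb l| ≤ 1) (hsc : ∀ l, |sc l| ≤ 1)
    (ha hb hc : Fin K → ℤ) (d : Fin K → ℕ) {lb : Fin K} (hlb : |sb lb| = 1) (hdb : Dom B sb hb d t lb)
    {Ma Mc : ℝ} (hMa : 0 ≤ Ma) (hMc : 0 ≤ Mc) (haM : Below B sa ha d t Ma) (hcM : Below B sc hc d t Mc)
    (hgap : B * (Ma * Mc) ≤ (tv B (hb lb) (d lb) t) ^ 2) :
    bnom B sa ha d t * bnom B sc hc d t - (bnom B sb hb d t) ^ 2 < 0 := by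
  have hK1 : (1 : ℝ) ≤ K := by exact_mod_cast hK
  have hB : 0 < B := by nlinarith
  set Vb := tv B (hb lb) (d lb) t with hVb
  have hVb0 : 0 < Vb := tv_pos hB _ _ ht
  have hq : (K : ℝ) / B ≤ 1 / 4 := by rw [div_le_iff₀ hB]; nlinarith
  have heb := abs_bnom_sub_le hB hsb hb d ht lb hdb
  have heb' : |bnom B sb hb d t - sb lb * Vb| ≤ 1 / 4 * Vb :=
    heb.trans (mul_le_mul_of_nonneg_right hq hVb0.le)
  -- |b| ≥ (3/4) Vb hence b² ≥ (9/16) Vb²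
  have h1 : 3 / 4 * Vb ≤ |bnom B sb hb d t| := by
    have htri := abs_sub_abs_le_abs_sub (sb lb * Vb) (bnom B sb hb d t)
    rw [abs_sub_comm] at htri
    have hsv : |sb lb * Vb| = Vb := by rw [abs_mul, hlb, one_mul, abs_of_pos hVb0]
    rw [hsv] at htri
    linarith
  have h2 : 9 / 16 * Vb ^ 2 ≤ (bnom B sb hb d t) ^ 2 := by
    rw [← sq_abs (bnom B sb hb d t)]
    nlinarith [abs_nonneg (bnom B sb hb d t)]
  -- |ac| ≤ K² Ma Mc ≤ Vb²/4
  have ha1 : |bnom B sa ha d t| ≤ (K : ℝ) * Ma := abs_bnom_le hB hsa ha d ht hMa haM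
  have hc1 : |bnom B sc hc d t| ≤ (K : ℝ) * Mc := abs_bnom_le hB hsc hc d ht hMc hcM
  have hac : |bnom B sa ha d t * bnom B sc hc d t| ≤ ((K : ℝ) * Ma) * ((K : ℝ) * Mc) := by
    rw [abs_mul]; exact mul_le_mul ha1 hc1 (abs_nonneg _) (by positivity)
  have hac2 : ((K : ℝ) * Ma) * ((K : ℝ) * Mc) ≤ 1 / 4 * Vb ^ 2 := by
    have e : ((K : ℝ) * Ma) * ((K : ℝ) * Mc) * B = (K : ℝ) ^ 2 * (B * (Ma * Mc)) := by ring
    have h' : ((K : ℝ) * Ma) * ((K : ℝ) * Mc) * B ≤ (K : ℝ) ^ 2 * Vb ^ 2 := by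
      rw [e]; exact mul_le_mul_of_nonneg_left hgap (by positivity)
    have h'' : (K : ℝ) ^ 2 * Vb ^ 2 ≤ (1 / 4 * Vb ^ 2) * B := by nlinarith [pow_pos hVb0 2]
    exact le_of_mul_le_mul_right (h'.trans h'') hB
  have hac3 := (abs_le.1 (hac.trans hac2)).2
  nlinarith [pow_pos hVb0 2]

/-! ## 3. Dominance at `B`-power points and across intervals -/

/-- at `t = B^x` dominance is an exponent comparison. [folklore] -/
theorem dom_zpow {B : ℝ} (hB : 1 < B) (s : Fin K → ℝ) (h : Fin K → ℤ) (d : Fin K → ℕ) (x : ℤ) (l₀ : Fin K)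
    (H : ∀ l, l ≠ l₀ → s l = 0 ∨ h l + x * d l + 1 ≤ h l₀ + x * d l₀) : Dom B s h d (B ^ x) l₀ := by
  intro l hl
  rcases H l hl with h0 | hle
  · exact Or.inl h0
  · right
    have hB0 : 0 < B := lt_trans zero_lt_one hB
    rw [tv_zpow hB0, tv_zpow hB0, mul_comm, ← zpow_add_one₀ hB0.ne']
    exact zpow_le_zpow_right₀ hB.le hle

/-- at `t = B^x` an exponent bound `E` bounds every term by `B^E`. [folklore] -/
theorem below_zpow {B : ℝ} (hB : 1 < B) (s : Fin K → ℝ) (h : Fin K → ℤ) (d : Fin K → ℕ) (x E : ℤ)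
    (H : ∀ l, s l = 0 ∨ h l + x * d l ≤ E) : Below B s h d (B ^ x) (B ^ E) := by
  intro l
  rcases H l with h0 | hle
  · exact Or.inl h0
  · right
    rw [tv_zpow (lt_trans zero_lt_one hB)]
    exact zpow_le_zpow_right₀ hB.le hle

/-- at `t = B^x`: `2E + 1 ≤ eₐ + e_c ⇒ B·(B^E)² ≤ tv_a · tv_c`. [folklore] -/
theorem gapU_zpow {B : ℝ} (hB : 1 < B) (ha hc x E : ℤ) (da dc : ℕ) (H : 2 * E + 1 ≤ ha + x * da + (hc + x * dc)) :
    B * (B ^ E) ^ 2 ≤ tv B ha da (B ^ x) * tv B hc dc (B ^ x) := by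
  have hB0 : 0 < B := lt_trans zero_lt_one hB
  rw [tv_zpow hB0, tv_zpow hB0, ← zpow_add₀ hB0.ne', ← zpow_natCast (B ^ E) 2, ← zpow_mul, mul_comm,
    ← zpow_add_one₀ hB0.ne']
  exact zpow_le_zpow_right₀ hB.le (by push_cast; linarith)

/-- at `t = B^x`: `Eₐ + E_c + 1 ≤ 2 e_b ⇒ B·(B^{Eₐ} B^{E_c}) ≤ tv_b²`. [folklore] -/
theorem gapW_zpow {B : ℝ} (hB : 1 < B) (hb x Ea Ec : ℤ) (db : ℕ) (H : Ea + Ec + 1 ≤ 2 * (hb + x * db)) :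
    B * (B ^ Ea * B ^ Ec) ≤ (tv B hb db (B ^ x)) ^ 2 := by
  have hB0 : 0 < B := lt_trans zero_lt_one hB
  rw [tv_zpow hB0, ← zpow_add₀ hB0.ne', ← zpow_natCast (B ^ (hb + x * db)) 2, ← zpow_mul, mul_comm,
    ← zpow_add_one₀ hB0.ne']
  exact zpow_le_zpow_right₀ hB.le (by push_cast; linarith)

/-- dominance with a unit to spare against a term of SMALLER exponent persists to the right of where it holds. [folklore] -/
theorem dom_mono_right {B : ℝ} (hB : 0 < B) {h₁ h₀ : ℤ} {d₁ d₀ : ℕ} (hd : d₁ ≤ d₀) {t₁ t : ℝ} (ht₁ : 0 < t₁)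
    (htt : t₁ ≤ t) (H : B * tv B h₁ d₁ t₁ ≤ tv B h₀ d₀ t₁) : B * tv B h₁ d₁ t ≤ tv B h₀ d₀ t := by
  obtain ⟨r, rfl⟩ := Nat.exists_eq_add_of_le hd
  unfold tv at H ⊢
  rw [pow_add] at H ⊢
  have h1 : B * B ^ h₁ ≤ B ^ h₀ * t₁ ^ r := by
    have H' : (B * B ^ h₁) * t₁ ^ d₁ ≤ (B ^ h₀ * t₁ ^ r) * t₁ ^ d₁ := by
      calc (B * B ^ h₁) * t₁ ^ d₁ = B * (B ^ h₁ * t₁ ^ d₁) := by ring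
        _ ≤ B ^ h₀ * (t₁ ^ d₁ * t₁ ^ r) := H
        _ = (B ^ h₀ * t₁ ^ r) * t₁ ^ d₁ := by ring
    exact le_of_mul_le_mul_right H' (pow_pos ht₁ _)
  have h2 : B ^ h₀ * t₁ ^ r ≤ B ^ h₀ * t ^ r :=
    mul_le_mul_of_nonneg_left (pow_le_pow_left₀ ht₁.le htt r) (zpow_pos hB _).le
  calc B * (B ^ h₁ * t ^ d₁) = (B * B ^ h₁) * t ^ d₁ := by ring
    _ ≤ (B ^ h₀ * t ^ r) * t ^ d₁ := mul_le_mul_of_nonneg_right (h1.trans h2) (pow_nonneg (ht₁.le.trans htt) _)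
    _ = B ^ h₀ * (t ^ d₁ * t ^ r) := by ring

/-- dominance with a unit to spare against a term of LARGER exponent persists to the left of where it holds. [folklore] -/
theorem dom_mono_left {B : ℝ} (hB : 0 < B) {h₁ h₀ : ℤ} {d₁ d₀ : ℕ} (hd : d₀ ≤ d₁) {t₂ t : ℝ} (ht : 0 < t)
    (htt : t ≤ t₂) (H : B * tv B h₁ d₁ t₂ ≤ tv B h₀ d₀ t₂) : B * tv B h₁ d₁ t ≤ tv B h₀ d₀ t := by
  obtain ⟨r, rfl⟩ := Nat.exists_eq_add_of_le hd
  have ht₂ : 0 < t₂ := lt_of_lt_of_le ht htt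
  unfold tv at H ⊢
  rw [pow_add] at H ⊢
  have h1 : B * B ^ h₁ * t₂ ^ r ≤ B ^ h₀ := by
    have H' : (B * B ^ h₁ * t₂ ^ r) * t₂ ^ d₀ ≤ B ^ h₀ * t₂ ^ d₀ := by
      calc (B * B ^ h₁ * t₂ ^ r) * t₂ ^ d₀ = B * (B ^ h₁ * (t₂ ^ d₀ * t₂ ^ r)) := by ring
        _ ≤ B ^ h₀ * t₂ ^ d₀ := H
    exact le_of_mul_le_mul_right H' (pow_pos ht₂ _)
  have h2 : B * B ^ h₁ * t ^ r ≤ B * B ^ h₁ * t₂ ^ r :=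
    mul_le_mul_of_nonneg_left (pow_le_pow_left₀ ht.le htt r) (by positivity)
  calc B * (B ^ h₁ * (t ^ d₀ * t ^ r)) = (B * B ^ h₁ * t ^ r) * t ^ d₀ := by ring
    _ ≤ B ^ h₀ * t ^ d₀ := mul_le_mul_of_nonneg_right (h2.trans h1) (pow_nonneg ht.le _)

/-- **bracketed zero** (intermediate value theorem): a sign change of a continuous `f` on `t₁ < t₂` gives a zero strictly
between. [folklore] -/
theorem exists_zero_of_sign_change {f : ℝ → ℝ} (hf : Continuous f) {t₁ t₂ : ℝ} (h12 : t₁ < t₂)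
    (hs : f t₁ * f t₂ < 0) : ∃ t, t₁ < t ∧ t < t₂ ∧ f t = 0 := by
  have hcont : ContinuousOn f (Set.Icc t₁ t₂) := hf.continuousOn
  rcases mul_neg_iff.1 hs with ⟨h1, h2⟩ | ⟨h1, h2⟩
  · obtain ⟨r, ⟨hr1, hr2⟩, hr⟩ := intermediate_value_Ioo' h12.le hcont ⟨h2, h1⟩
    exact ⟨r, hr1, hr2, hr⟩
  · obtain ⟨r, ⟨hr1, hr2⟩, hr⟩ := intermediate_value_Ioo h12.le hcont ⟨h1, h2⟩
    exact ⟨r, hr1, hr2, hr⟩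

end Summit.ValiantsHypothesis.ValiantsHypothesis.Theorems.LacunarySymmetroidMatrixDescartes.VSQ
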